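import Summits.CriticalPhenomena.CardyFormulaZ2.Theses.CardySelfRefinement
import Literature.Probability.RandomPlanarGeometry.SLEUniquenessInLaw

/-!
# Sketch — crux-ideate stmt-CriticalPhenomena-10279 (`CardySelfRefinement.SubseqUpgrade`), ideator 2

Idea `scalar-subseq-sle-uniqueness`: FIRST LEMMA = the model-free, κ-general subsequence
principle `convergesInLawToSLE_of_forall_seq_subseq` (the transfer C⁺ of the card), and the
crux by instantiation (`SubseqUpgrade_of`).  Cheapest falsifier of the idea = "does this
elaborate sorry-free?" — it is written out in full below so that `lean check` answers it.

Inputs by name: Mathlib `Filter.tendsto_of_subseq_tendsto`, `tendsto_nhdsWithin_iff`,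
`MeasureTheory.integral_map`, `tendsto_one_div_add_atTop_nhds_zero_nat`, `Nat.one_div_pos_of_nat`;
tree `IsSLELaw.eq_map_of_isSLECurve` (SLEUniquenessInLaw.lean: uniqueness of the chordal SLE_κ
law, UNCONDITIONAL since `IsSLECurve.map_eq_holds`), `IsSLECurve.aemeasurable`,
`ConvergesInLawToSLE` / `TendstoLaw` (SLE.lean / CurveSpace.lean).
-/

open Filter Topology MeasureTheory
open scoped NNReal BoundedContinuousFunction

namespace Summit.CriticalPhenomena.CardyFormulaZ2.Cruxes.SubseqUpgrade.ScalarSubseq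

open Literature.Probability.RandomPlanarGeometry

/-- **First lemma / transfer C⁺ (model-free subsequence principle for SLE_κ limits).**
Random curves `Y δ : Ωδ δ → CurveClass ℂ` under laws `P δ`, eventually a.e.-measurable; if every
sequence of positive meshes `s n → 0` has a subsequence along which `Y` converges, in the
bounded-continuous-test-function sense, to SOME chordal SLE_κ law of `(D; a, b)`, then
`Y δ → SLE_κ` in law along `𝓝[>] 0` (`ConvergesInLawToSLE κ D Y P`).  Per test function `f` this
is `Filter.tendsto_of_subseq_tendsto` in `ℝ` on the countably generated filter `𝓝[>] 0`; the only
global input is uniqueness of the SLE_κ law in `D` (`IsSLELaw.eq_map_of_isSLECurve`). -/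
theorem convergesInLawToSLE_of_forall_seq_subseq {κ : ℝ≥0} {D : DobrushinDomain}
    {Ωδ : ℝ → Type*} [∀ δ, MeasurableSpace (Ωδ δ)]
    {Y : ∀ δ, Ωδ δ → CurveClass ℂ} {P : ∀ δ, Measure (Ωδ δ)}
    (hY : ∀ᶠ δ in 𝓝[>] (0 : ℝ), AEMeasurable (Y δ) (P δ))
    (hsub : ∀ s : ℕ → ℝ, (∀ n, 0 < s n) → Tendsto s atTop (𝓝 0) →
      ∃ φ : ℕ → ℕ, StrictMono φ ∧ ∃ μ : Measure (CurveClass ℂ), IsSLELaw κ D μ ∧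
        ∀ f : CurveClass ℂ →ᵇ ℝ,
          Tendsto (fun n ↦ ∫ ω, f (Y (s (φ n)) ω) ∂P (s (φ n))) atTop (𝓝 (∫ γ, f γ ∂μ))) :
    ConvergesInLawToSLE κ D Y P := by
  -- an SLE_κ random curve `Γ`, read off the limit along the canonical sequence `1/(n+1)`
  obtain ⟨φ₀, -, μ₀, hμ₀, -⟩ := hsub (fun n ↦ 1 / ((n : ℝ) + 1))
    (fun n ↦ Nat.one_div_pos_of_nat) tendsto_one_div_add_atTop_nhds_zero_nat
  obtain ⟨Γ, hΓ, rfl⟩ := hμ₀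
  refine ⟨Γ, hΓ, hY, fun f ↦ ?_⟩
  -- scalar subsequence principle on `𝓝[>] 0`
  refine tendsto_of_subseq_tendsto fun s hs ↦ ?_
  rw [tendsto_nhdsWithin_iff] at hs
  obtain ⟨hs0, hpos⟩ := hs
  obtain ⟨N, hN⟩ := eventually_atTop.1 hpos
  -- shift past the finitely many non-positive meshes, then use the hypothesis
  obtain ⟨φ, -, μ, hμ, hlim⟩ := hsub (fun n ↦ s (n + N)) (fun n ↦ hN _ (N.le_add_left n))
    (hs0.comp (tendsto_add_atTop_nat N))
  refine ⟨fun n ↦ φ n + N, ?_⟩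
  have h := hlim f
  -- the subsequential limit law is THE SLE_κ law of `D`, i.e. the law of `Γ`
  rw [hμ.eq_map_of_isSLECurve hΓ,
    integral_map hΓ.aemeasurable f.continuous.aestronglyMeasurable] at h
  exact h

/-- **The crux by instantiation**: `Y δ = bondInterfaceIn D (E δ)`, `P δ = P_{1/2}` on bond-ℤ²,
`κ = 6`; the hypothesis of `SubseqUpgrade` is specialised to the one pair `(D, E)` at hand (its
"for all `(D, E)` at once" and "one family `P` for all `D`" clauses are simply discarded). -/
theorem SubseqUpgrade_of :
    Summit.CriticalPhenomena.CardyFormulaZ2.Theses.CardySelfRefinement.SubseqUpgrade := by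
  rintro ⟨hmeas, hsub⟩ D E hE
  refine convergesInLawToSLE_of_forall_seq_subseq (hmeas D E hE) fun s hs hs0 ↦ ?_
  obtain ⟨φ, hφ, P, hP, hlim⟩ := hsub s hs hs0
  exact ⟨φ, hφ, P D, hP D, hlim D E hE⟩

end Summit.CriticalPhenomena.CardyFormulaZ2.Cruxes.SubseqUpgrade.ScalarSubseq
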